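/-
Copyright (c) 2026 the pub-hodgecm-mathlib formalisation cell (harness21).  Prover seat hodgecm-mathlib-B-p14 (g35): road «S3-tree» (LEAD F0P3a-plan (g11) WORD T10-2; architect A-p16 (g28)
census «S3» v3 = DEAL SHEET, acting architect F0P3-p01 (g16)), brick T1 «the `U(3)_v` tree», file T1b-2 = TYPES: (D1)–(D4), PARITY, `d ≤ N`, the `N = 3` types; 2026-09-01.
-/
import Literature.NumberTheory.Automorphic.UnitaryLatticeTreeDual                      -- ★ T1b-1 (B-p14 (g35)): the dual-lattice calculus
import Literature.NumberTheory.Automorphic.HyperspecialUnitaryCartanIwasawaUniqueness   -- ★ `CartanUnique.v_det_le_one_of_forall_v_le_one`, `v_adjugate_apply_le_one`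
import HarnessLib

/-!
# The lattice graph of a hermitian space — III: TYPES — comparable vertices of the same type are equal (D1)–(D2), the type is even and `≤ N` (at `N = 3`: `0` or `2` — no
# `ϖ`-modular rank-3 lattice), a vertex below `ϖ^kL₀` lies in `ϖ^{-k}L₀` (D3)–(D4) (Jacobowitz 1962 §7–§8; Bruhat–Tits 1972 §10; Serre, *Trees* II.1.1)

Topic `NumberTheory/Automorphic`; namespace `Literature.NumberTheory.Automorphic.UnitaryLatticeTree`.  THEOREMS ONLY (no definition, no instance, no notation, no named fact,
no `sorry`); kernel lane.  Cell `pub/hodgecm-mathlib` (D-0151), crux H413 = `stmt-HodgeConjecture-24833`; road «S3-tree» (census «S3» v3 §1 rulings A-49/A-53), brick **T1** over the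
definitions ★ `UnitaryLatticeTreeDefs` (T1a; rank-`N` sibling of ★ `HermitianLatticeTree*`, `Valued K ℤᵐ⁰` currency).  HONEST LABEL: HC_CM is proved only modulo the 2 remaining named inputs (hLiu418 24832, h413 24833) until rung 0 closes; nothing printed is asserted here (elementary lattice
algebra over a valuation ring); S3 stays a print row until the road's END lands.

* §9 `isIntMatrix_nonsing_inv_of_v_det_eq_one`, **`eq_of_le_of_isVertexLattice`** ((D1)–(D2): `M ≤ M′` of the same type `d` ⇒ `M = M′`).
* §10 **`even_of_isVertexLattice`** (unimodular `H`, `ϖ` a uniformiser, `σ` valuation-preserving ⇒ `d` even), **`le_of_isVertexLattice`** (`d ≤ N`),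
  **`type_eq_zero_or_two_of_isVertexLattice_three`** (`N = 3`: `d = 0 ∨ d = 2` — the two vertex types of the `U(3)` tree; census «T1» §1).
* §11 `mem_scaleLattice_iff`, `mem_scaleLattice_stdLattice_iff`, `scaleLattice_stdLattice_congr`, `le_dualLatt_of_isVertexLattice`, `scaleLattice_dualLatt_le_of_isVertexLattice`,
  **`le_scaleLattice_of_isVertexLattice`** ((D3)–(D4): `ϖ^kL₀ ≤ M ⇒ M ≤ ϖ^{-k}L₀` for every vertex `M` and unimodular `H`).

## References
* [BruhatTits1972] F. Bruhat, J. Tits, *Groupes réductifs sur un corps local I*, Publ. Math. IHÉS 41 (1972), §10 (the building of a rank-one group is a tree).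
* [Tits1979] J. Tits, *Reductive groups over local fields*, PSPM 33.1 (1979), §3.3.3 (hyperspecial `K₀ = 𝒢(𝒪)`), §2.4 (quasi-split unitary groups).
* [Serre1980Trees] J.-P. Serre, *Trees* (1980), Ch. II §1.1 (the tree of `SL₂`: lattices, adjacency, distance from a base lattice).
* [Jacobowitz1962] R. Jacobowitz, *Hermitian forms over local fields*, Amer. J. Math. 84 (1962), §4, §7–§8 (Gram matrices, unimodular and `𝔭`-modular hermitian lattices).
* [Omeara1963] O. T. O'Meara, *Introduction to Quadratic Forms* (1963), §82F (primitive vectors, unimodular lattices).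
-/

set_option autoImplicit false

noncomputable section

open scoped Valued WithZero Matrix MatrixGroups

namespace Literature.NumberTheory.Automorphic.UnitaryLatticeTree

open Literature.NumberTheory.Automorphic Literature.NumberTheory.Automorphic.HermitianLattice
open Literature.NumberTheory.Automorphic.CartanUnique

variable {K : Type*} [Field K] [Valued K ℤᵐ⁰] {N : ℕ}

/-! ## §8 Duality: `M^♯♯ = M`, the vertex conditions intrinsically, scaling, the root -/

omit [Valued K ℤᵐ⁰] in
/-- `σ` commutes with matrix inversion: `(A⁻¹).map σ = (A.map σ)⁻¹` (`A` invertible). [cite: Jacobowitz1962, §4] -/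
theorem map_nonsing_inv (σ : K →+* K) {A : Matrix (Fin N) (Fin N) K} (hA : IsUnit A.det) : (A⁻¹).map σ = (A.map σ)⁻¹ := by
  symm
  apply Matrix.inv_eq_right_inv
  rw [← Matrix.map_mul, Matrix.mul_nonsing_inv _ hA, Matrix.map_one σ (map_zero σ) (map_one σ)]

/-- **`M^♯♯ = M` for `M = latt A`** (`H` HERMITIAN: `(σH)ᵀ = H`; `σ` an involution preserving `v`; `A`, `H` invertible): with `B = (σA)ᵀH` one has `M^♯ = latt B⁻¹` and
`((σB⁻¹)ᵀ H)⁻¹ = ((HA)⁻¹H)⁻¹ = A`. [cite: Jacobowitz1962, §4] [cite: Serre1980Trees, II.1.1] -/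
theorem dualLatt_dualLatt_latt (σ : K →+* K) (hσ : ∀ a, σ (σ a) = a) (hvσ : ∀ a, Valued.v (σ a) = Valued.v a) {H : Matrix (Fin N) (Fin N) K}
    (hH : IsUnit H.det) (hHh : (H.map σ)ᵀ = H) {A : Matrix (Fin N) (Fin N) K} (hA : IsUnit A.det) :
    dualLatt σ H (dualLatt σ H (latt A)) = latt A := by
  have hB : IsUnit ((A.map σ)ᵀ * H).det := by rw [Matrix.det_mul]; exact (isUnit_det_transpose_map σ hA).mul hH
  have hBinv : IsUnit ((A.map σ)ᵀ * H)⁻¹.det := Matrix.isUnit_nonsing_inv_det_iff.2 hB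
  rw [dualLatt_latt_eq σ hvσ hH hA, dualLatt_latt_eq σ hvσ hH hBinv]
  congr 1
  -- `((σ B⁻¹)ᵀ H)⁻¹ = A`
  have hAσσ : (A.map σ).map σ = A := by ext i j; simp only [Matrix.map_apply, hσ]
  have h1 : ((((A.map σ)ᵀ * H)⁻¹).map σ)ᵀ = (H * A)⁻¹ := by
    rw [map_nonsing_inv σ hB, Matrix.transpose_nonsing_inv, Matrix.map_mul, Matrix.transpose_mul, Matrix.transpose_map, Matrix.transpose_transpose,
      hAσσ, hHh]
  have hHA : IsUnit (H * A).det := by rw [Matrix.det_mul]; exact hH.mul hA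
  rw [h1, Matrix.mul_inv_rev, Matrix.nonsing_inv_nonsing_inv _ hHA, ← Matrix.mul_assoc, Matrix.nonsing_inv_mul _ hH, Matrix.one_mul]

/-- **`M ≤ M^♯` iff the Gram matrix is integral** (`M = latt A`, any `A`): `latt A ≤ (latt A)^♯ ↔ (σA)ᵀHA` integral. [cite: Jacobowitz1962, §7] -/
theorem latt_le_dualLatt_latt_iff (σ : K →+* K) (hvσ : ∀ a, Valued.v (σ a) = Valued.v a) (H A : Matrix (Fin N) (Fin N) K) :
    latt A ≤ dualLatt σ H (latt A) ↔ IsIntMatrix ((A.map σ)ᵀ * H * A) := by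
  constructor
  · intro h i j
    have hij := h (mulVec_single_mem_latt A j) _ (mulVec_single_mem_latt A i)
    rwa [pairing_mulVec_left, pairing_mulVec_right, pairing_single_single] at hij
  · intro hG x hx y hy
    obtain ⟨u, hu, rfl⟩ := Submodule.mem_map.1 hx
    obtain ⟨u', hu', rfl⟩ := Submodule.mem_map.1 hy
    simp only [LinearMap.restrictScalars_apply, Matrix.toLin'_apply]
    rw [pairing_mulVec_left, pairing_mulVec_right, pairing_eq_dotProduct]
    exact (forall_v_dotProduct_le_one_iff σ hvσ _).2 (mulVec_mem_stdLattice_of_forall_v_le_one hG hu) u' hu'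

/-- Scaling a column lattice: `c · latt A = latt (c • A)`. [cite: Serre1980Trees, II.1.1] -/
theorem scaleLattice_latt (c : K) (A : Matrix (Fin N) (Fin N) K) : scaleLattice c (latt A) = latt (c • A) := by
  rw [scaleLattice, latt, latt, ← Submodule.map_comp]
  congr 1
  apply LinearMap.ext
  intro x
  simp

/-- **`ϖM^♯ ≤ M` iff `ϖ·G⁻¹` is integral** (`M = latt A`, `G = (σA)ᵀHA`; `A`, `H` invertible). [cite: Jacobowitz1962, §8] -/
theorem scaleLattice_dualLatt_latt_le_iff (σ : K →+* K) (hvσ : ∀ a, Valued.v (σ a) = Valued.v a) {H : Matrix (Fin N) (Fin N) K} (hH : IsUnit H.det)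
    {A : Matrix (Fin N) (Fin N) K} (hA : IsUnit A.det) (ϖ : K) :
    scaleLattice ϖ (dualLatt σ H (latt A)) ≤ latt A ↔ IsIntMatrix (ϖ • ((A.map σ)ᵀ * H * A)⁻¹) := by
  rw [dualLatt_latt_eq σ hvσ hH hA, scaleLattice_latt, latt_le_latt_iff hA, Matrix.mul_smul, ← Matrix.mul_inv_rev]

/-- **The dual of a scaled lattice: `(c·M)^♯ = (σc)⁻¹ · M^♯`** (`c ≠ 0`). [cite: Jacobowitz1962, §4] -/
theorem dualLatt_scaleLattice (σ : K →+* K) (H : Matrix (Fin N) (Fin N) K) {c : K} (hc : c ≠ 0) (M : Submodule 𝒪[K] (Fin N → K)) :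
    dualLatt σ H (scaleLattice c M) = scaleLattice (σ c)⁻¹ (dualLatt σ H M) := by
  have hσc : σ c ≠ 0 := (map_ne_zero σ).2 hc
  ext x
  simp only [mem_dualLatt, scaleLattice, Submodule.mem_map, LinearMap.restrictScalars_apply, LinearMap.smul_apply, LinearMap.id_apply]
  constructor
  · intro h
    refine ⟨σ c • x, fun y hy => ?_, by rw [smul_smul, inv_mul_cancel₀ hσc, one_smul]⟩
    have := h (c • y) ⟨y, hy, rfl⟩
    rwa [map_smulₛₗ, LinearMap.smul_apply, smul_eq_mul, ← smul_eq_mul, ← map_smul] at this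
  · rintro ⟨x', hx', rfl⟩ y ⟨y', hy', rfl⟩
    rw [map_smulₛₗ (pairing σ H), LinearMap.smul_apply, smul_eq_mul, LinearMap.map_smul (pairing σ H y'), smul_eq_mul, ← mul_assoc,
      mul_inv_cancel₀ hσc, one_mul]
    exact hx' y' hy'

/-- **The dual of the root: `(𝒪^N)^♯ = latt H⁻¹`**, hence `= 𝒪^N` for a unimodular form (`H`, `H⁻¹` integral). [cite: Jacobowitz1962, §7] -/
theorem dualLatt_stdLattice (σ : K →+* K) (hvσ : ∀ a, Valued.v (σ a) = Valued.v a) {H : Matrix (Fin N) (Fin N) K} (hH : IsUnit H.det) :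
    dualLatt σ H (stdLattice K N) = latt H⁻¹ := by
  rw [← latt_one, dualLatt_latt_eq σ hvσ hH (by rw [Matrix.det_one]; exact isUnit_one), Matrix.map_one σ (map_zero σ) (map_one σ),
    Matrix.transpose_one, Matrix.one_mul]

/-- The root is self-dual for a unimodular form: `(𝒪^N)^♯ = 𝒪^N` when `H` and `H⁻¹` are integral. [cite: Jacobowitz1962, §7] -/
theorem dualLatt_stdLattice_eq_self (σ : K →+* K) (hvσ : ∀ a, Valued.v (σ a) = Valued.v a) {H : Matrix (Fin N) (Fin N) K} (hH : IsUnit H.det)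
    (hHi : IsIntMatrix H) (hHi' : IsIntMatrix H⁻¹) : dualLatt σ H (stdLattice K N) = stdLattice K N := by
  rw [dualLatt_stdLattice σ hvσ hH]
  refine le_antisymm ((latt_le_stdLattice_iff _).2 hHi') ?_
  rw [← latt_one, latt_le_latt_iff (Matrix.isUnit_nonsing_inv_det_iff.2 hH), Matrix.nonsing_inv_nonsing_inv _ hH, Matrix.mul_one]
  exact hHi

/-! ## §9 (D1)–(D2): comparable vertices of the same type are equal -/

/-- An integral matrix whose determinant is a unit of `𝒪` has an integral inverse. [cite: Serre1980Trees, II.1.1] -/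
theorem isIntMatrix_nonsing_inv_of_v_det_eq_one {P : Matrix (Fin N) (Fin N) K} (hP : IsIntMatrix P) (hdet : Valued.v P.det = 1) : IsIntMatrix P⁻¹ := by
  have hP0 : P.det ≠ 0 := fun h => by rw [h, map_zero] at hdet; exact zero_ne_one hdet
  intro i j
  rw [Matrix.inv_def, Matrix.smul_apply, smul_eq_mul, map_mul, Ring.inverse_eq_inv', map_inv₀, hdet, inv_one, one_mul]
  exact v_adjugate_apply_le_one hP i j

/-- **(D1)–(D2): COMPARABLE VERTICES OF THE SAME TYPE ARE EQUAL** (`σ` valuation-preserving, `ϖ ≠ 0`): if `M ≤ M′` are vertices of the same type `d` then `M = M′` — `M = latt g`,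
`M′ = latt g′`, `P := g′⁻¹g` is integral with `v(det P)² = 1`, so `P ∈ GL_N(𝒪)`.  At `N = 3`: two distinct self-dual (resp. type-two) vertices are never comparable. [cite: Serre1980Trees, II.1.1] [cite: Jacobowitz1962, §7–§8] -/
theorem eq_of_le_of_isVertexLattice {σ : K →+* K} (hvσ : ∀ a, Valued.v (σ a) = Valued.v a) {ϖ : K} (hϖ : ϖ ≠ 0) {H : Matrix (Fin N) (Fin N) K} {d : ℕ}
    {M M' : Submodule 𝒪[K] (Fin N → K)} (hM : IsVertexLattice σ ϖ H d M) (hM' : IsVertexLattice σ ϖ H d M') (h : M ≤ M') : M = M' := by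
  obtain ⟨g, rfl, -, -, hdet⟩ := hM
  obtain ⟨g', rfl, -, -, hdet'⟩ := hM'
  have hg' : IsUnit (g' : Matrix (Fin N) (Fin N) K).det := Matrix.isUnits_det_units g'
  set P : Matrix (Fin N) (Fin N) K := (g' : Matrix (Fin N) (Fin N) K)⁻¹ * (g : Matrix (Fin N) (Fin N) K) with hPdef
  have hPint : IsIntMatrix P := (latt_le_latt_iff hg' _).1 h
  have hgP : (g : Matrix (Fin N) (Fin N) K) = (g' : Matrix (Fin N) (Fin N) K) * P := by
    rw [hPdef, ← Matrix.mul_assoc, Matrix.mul_nonsing_inv _ hg', Matrix.one_mul]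
  -- `det G = det G' · det P · σ(det P)`
  have hG : formCongr σ g H = (P.map σ)ᵀ * formCongr σ g' H * P := by
    simp only [formCongr, hgP, Matrix.map_mul, Matrix.transpose_mul, Matrix.mul_assoc]
  have hvP : Valued.v P.det = 1 := by
    have hle : Valued.v P.det ≤ 1 := v_det_le_one_of_forall_v_le_one hPint
    have hv : Valued.v (formCongr σ g H).det = Valued.v P.det * Valued.v (formCongr σ g' H).det * Valued.v P.det := by
      rw [hG, Matrix.det_mul, Matrix.det_mul, map_mul, map_mul, Matrix.det_transpose, ← RingHom.mapMatrix_apply, ← RingHom.map_det, hvσ]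
    rw [hdet, hdet'] at hv
    have hϖd : Valued.v ϖ ^ d ≠ 0 := pow_ne_zero _ ((Valuation.ne_zero_iff _).2 hϖ)
    have hsq : Valued.v P.det * Valued.v P.det = 1 := by
      have : Valued.v ϖ ^ d * (Valued.v P.det * Valued.v P.det) = Valued.v ϖ ^ d * 1 := by
        rw [mul_one]
        calc Valued.v ϖ ^ d * (Valued.v P.det * Valued.v P.det) = Valued.v P.det * Valued.v ϖ ^ d * Valued.v P.det := by
              rw [mul_comm (Valued.v P.det) (Valued.v ϖ ^ d), mul_assoc]
          _ = Valued.v ϖ ^ d := hv.symm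
      exact mul_left_cancel₀ hϖd this
    by_contra hne
    have hlt : Valued.v P.det < 1 := lt_of_le_of_ne hle hne
    have : Valued.v P.det * Valued.v P.det < 1 := by
      calc Valued.v P.det * Valued.v P.det ≤ Valued.v P.det * 1 := mul_le_mul' le_rfl hle
        _ < 1 := by rw [mul_one]; exact hlt
    exact (lt_irrefl _) (hsq ▸ this)
  refine le_antisymm h ((latt_le_latt_iff (Matrix.isUnits_det_units g) _).2 ?_)
  have hPinv : (g : Matrix (Fin N) (Fin N) K)⁻¹ * (g' : Matrix (Fin N) (Fin N) K) = P⁻¹ := by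
    rw [hPdef, Matrix.mul_inv_rev, Matrix.nonsing_inv_nonsing_inv _ hg']
  rw [hPinv]
  exact isIntMatrix_nonsing_inv_of_v_det_eq_one hPint hvP

/-! ## §10 The type of a vertex: `d` is EVEN and `d ≤ N` (so `d ∈ {0, 2}` at `N = 3`, `d ∈ {0, 2}` at `N = 2`) -/

/-- **The type is even**: for a unimodular form (`v(det H) = 1`), a uniformiser `ϖ` and a valuation-preserving `σ`, every vertex has EVEN type `d` — `v(det G) = v(det g)·v(σ det g) = v(det g)²`.
At `N = 3` this excludes `d ∈ {1, 3}`: there is NO `ϖ`-modular rank-3 lattice. [cite: Jacobowitz1962, §8] [cite: BruhatTits1972, §10] -/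
theorem even_of_isVertexLattice {σ : K →+* K} (hvσ : ∀ a, Valued.v (σ a) = Valued.v a) {ϖ : K} (hϖ : Valued.v ϖ = WithZero.exp (-1 : ℤ))
    {H : Matrix (Fin N) (Fin N) K} (hH : Valued.v H.det = 1) {d : ℕ} {M : Submodule 𝒪[K] (Fin N → K)} (hM : IsVertexLattice σ ϖ H d M) : Even d := by
  obtain ⟨g, -, -, -, hdet⟩ := hM
  have hg0 : Valued.v (g : Matrix (Fin N) (Fin N) K).det ≠ 0 :=
    (Valuation.ne_zero_iff _).2 (Matrix.isUnits_det_units g).ne_zero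
  obtain ⟨m, hm⟩ : ∃ m : ℤ, Valued.v (g : Matrix (Fin N) (Fin N) K).det = WithZero.exp m :=
    ⟨WithZero.log (Valued.v (g : Matrix (Fin N) (Fin N) K).det), (WithZero.exp_log hg0).symm⟩
  have hv : Valued.v (formCongr σ g H).det = WithZero.exp (m + m) := by
    rw [formCongr, Matrix.det_mul, Matrix.det_mul, Matrix.det_transpose, ← RingHom.mapMatrix_apply, ← RingHom.map_det, map_mul, map_mul, hvσ, hH,
      mul_one, hm, ← WithZero.exp_add]
  rw [hdet, hϖ, ← WithZero.exp_nsmul, WithZero.exp_inj, nsmul_eq_mul] at hv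
  exact ⟨(-m).toNat, by omega⟩

/-- **The type is at most `N`**: `ϖ·G⁻¹` integral gives `v(ϖ^N) ≤ v(det G) = v(ϖ)^d`. [cite: Jacobowitz1962, §8] -/
theorem le_of_isVertexLattice {σ : K →+* K} {ϖ : K} (hϖ : Valued.v ϖ = WithZero.exp (-1 : ℤ)) {H : Matrix (Fin N) (Fin N) K} {d : ℕ}
    {M : Submodule 𝒪[K] (Fin N → K)} (hM : IsVertexLattice σ ϖ H d M) : d ≤ N := by
  obtain ⟨g, -, -, hint, hdet⟩ := hM
  have hϖ0 : Valued.v ϖ ≠ 0 := by rw [hϖ]; exact WithZero.coe_ne_zero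
  have hG0 : (formCongr σ g H).det ≠ 0 := fun h0 => by
    rw [h0, map_zero] at hdet; exact pow_ne_zero d hϖ0 hdet.symm
  have hle : Valued.v (ϖ • (formCongr σ g H)⁻¹).det ≤ 1 := v_det_le_one_of_forall_v_le_one hint
  rw [Matrix.det_smul, Fintype.card_fin, Matrix.det_nonsing_inv, Ring.inverse_eq_inv', map_mul, map_pow, map_inv₀, hdet, hϖ,
    ← WithZero.exp_nsmul, ← WithZero.exp_nsmul, ← WithZero.exp_neg, ← WithZero.exp_add, ← WithZero.exp_zero, WithZero.exp_le_exp] at hle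
  simp only [nsmul_eq_mul, mul_neg, mul_one] at hle
  omega

end Literature.NumberTheory.Automorphic.UnitaryLatticeTree

namespace Literature.NumberTheory.Automorphic.UnitaryLatticeTree

open Literature.NumberTheory.Automorphic Literature.NumberTheory.Automorphic.HermitianLattice
open Literature.NumberTheory.Automorphic.CartanUnique

variable {K : Type*} [Field K] [Valued K ℤᵐ⁰] {N : ℕ}

/-- **At `N = 3` a vertex has type `0` or `2`** (even and `≤ 3`): self-dual or «type one» of the S3-T0 tables; no `ϖ`-modular rank-3 lattice. [cite: BruhatTits1972, §10] [cite: Tits1979, §2.4] -/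
theorem type_eq_zero_or_two_of_isVertexLattice_three {σ : K →+* K} (hvσ : ∀ a, Valued.v (σ a) = Valued.v a) {ϖ : K} (hϖ : Valued.v ϖ = WithZero.exp (-1 : ℤ))
    {H : Matrix (Fin 3) (Fin 3) K} (hH : Valued.v H.det = 1) {d : ℕ} {M : Submodule 𝒪[K] (Fin 3 → K)} (hM : IsVertexLattice σ ϖ H d M) : d = 0 ∨ d = 2 := by
  obtain ⟨r, hr⟩ := even_of_isVertexLattice hvσ hϖ hH hM
  have hle := le_of_isVertexLattice hϖ hM
  omega

/-! ## §11 Scaling the root; (D3)–(D4): a vertex below `ϖ^k L₀` lies in `ϖ^{-k} L₀` -/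

/-- Membership in a scaled lattice: `x ∈ c·M ↔ c⁻¹x ∈ M` (`c ≠ 0`). [cite: Serre1980Trees, II.1.1] -/
theorem mem_scaleLattice_iff {c : K} (hc : c ≠ 0) (M : Submodule 𝒪[K] (Fin N → K)) (x : Fin N → K) : x ∈ scaleLattice c M ↔ c⁻¹ • x ∈ M := by
  rw [scaleLattice, Submodule.mem_map]
  constructor
  · rintro ⟨y, hy, rfl⟩
    rw [LinearMap.restrictScalars_apply, LinearMap.smul_apply, LinearMap.id_apply, smul_smul, inv_mul_cancel₀ hc, one_smul]
    exact hy
  · intro h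
    exact ⟨c⁻¹ • x, h, by rw [LinearMap.restrictScalars_apply, LinearMap.smul_apply, LinearMap.id_apply, smul_smul, mul_inv_cancel₀ hc, one_smul]⟩

/-- Membership in the scaled root: `x ∈ c·𝒪^N ↔ ∀ i, |x_i| ≤ |c|` (`c ≠ 0`). [cite: Serre1980Trees, II.1.1] -/
theorem mem_scaleLattice_stdLattice_iff {c : K} (hc : c ≠ 0) (x : Fin N → K) : x ∈ scaleLattice c (stdLattice K N) ↔ ∀ i, Valued.v (x i) ≤ Valued.v c := by
  rw [mem_scaleLattice_iff hc, mem_stdLattice]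
  have hvc : Valued.v c ≠ 0 := (Valuation.ne_zero_iff _).2 hc
  refine forall_congr' fun i => ?_
  rw [Pi.smul_apply, smul_eq_mul, map_mul, map_inv₀, ← div_eq_inv_mul, div_le_one₀ (zero_lt_iff.2 hvc)]

/-- The scaled root depends only on the valuation of the scalar. [cite: Serre1980Trees, II.1.1] -/
theorem scaleLattice_stdLattice_congr {c c' : K} (hc : c ≠ 0) (h : Valued.v c = Valued.v c') : scaleLattice c (stdLattice K N) = scaleLattice c' (stdLattice K N) := by
  have hc' : c' ≠ 0 := fun h0 => by rw [h0, map_zero] at h; exact (Valuation.ne_zero_iff _).2 hc h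
  ext x
  rw [mem_scaleLattice_stdLattice_iff hc, mem_scaleLattice_stdLattice_iff hc', h]

/-- A vertex lies in its dual: `M ≤ M^♯`. [cite: Jacobowitz1962, §7–§8] -/
theorem le_dualLatt_of_isVertexLattice {σ : K →+* K} (hvσ : ∀ a, Valued.v (σ a) = Valued.v a) {ϖ : K} {H : Matrix (Fin N) (Fin N) K} {d : ℕ}
    {M : Submodule 𝒪[K] (Fin N → K)} (hM : IsVertexLattice σ ϖ H d M) : M ≤ dualLatt σ H M := by
  obtain ⟨g, rfl, hG, -, -⟩ := hM
  exact (latt_le_dualLatt_latt_iff σ hvσ H _).2 hG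

/-- A vertex contains `ϖ` times its dual: `ϖM^♯ ≤ M` (`H` invertible). [cite: Jacobowitz1962, §7–§8] -/
theorem scaleLattice_dualLatt_le_of_isVertexLattice {σ : K →+* K} (hvσ : ∀ a, Valued.v (σ a) = Valued.v a) {ϖ : K} {H : Matrix (Fin N) (Fin N) K} (hH : IsUnit H.det)
    {d : ℕ} {M : Submodule 𝒪[K] (Fin N → K)} (hM : IsVertexLattice σ ϖ H d M) : scaleLattice ϖ (dualLatt σ H M) ≤ M := by
  obtain ⟨g, rfl, -, hG', -⟩ := hM
  exact (scaleLattice_dualLatt_latt_le_iff σ hvσ hH (Matrix.isUnits_det_units g) ϖ).2 hG'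

/-- **(D3)–(D4): a vertex `M` with `ϖ^k L₀ ≤ M` satisfies `M ≤ ϖ^{-k} L₀`** (unimodular `H`: `H`, `H⁻¹` integral; `σ` valuation-preserving; `ϖ ≠ 0`): `M ≤ M^♯ ≤ (ϖ^kL₀)^♯ = (σϖ^k)⁻¹L₀`.
At `N = 3` this is the rank-3 form of ★ `le_scaleLattice_of_isSelfDualLattice` ∕ `…_of_isModularLattice` (for EVERY type the bound is `ϖ^{-k}L₀`). [cite: Serre1980Trees, II.1.1] -/
theorem le_scaleLattice_of_isVertexLattice {σ : K →+* K} (hvσ : ∀ a, Valued.v (σ a) = Valued.v a) {ϖ : K} (hϖ : ϖ ≠ 0) {H : Matrix (Fin N) (Fin N) K}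
    (hH : IsUnit H.det) (hHi : IsIntMatrix H) (hHi' : IsIntMatrix H⁻¹) {d : ℕ} {M : Submodule 𝒪[K] (Fin N → K)} (hM : IsVertexLattice σ ϖ H d M) {k : ℕ}
    (hk : scaleLattice (ϖ ^ k) (stdLattice K N) ≤ M) : M ≤ scaleLattice (ϖ ^ k)⁻¹ (stdLattice K N) := by
  have hϖk : ϖ ^ k ≠ 0 := pow_ne_zero _ hϖ
  calc M ≤ dualLatt σ H M := le_dualLatt_of_isVertexLattice hvσ hM
    _ ≤ dualLatt σ H (scaleLattice (ϖ ^ k) (stdLattice K N)) := dualLatt_antitone σ H hk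
    _ = scaleLattice (σ (ϖ ^ k))⁻¹ (stdLattice K N) := by rw [dualLatt_scaleLattice σ H hϖk, dualLatt_stdLattice_eq_self σ hvσ hH hHi hHi']
    _ = scaleLattice (ϖ ^ k)⁻¹ (stdLattice K N) := scaleLattice_stdLattice_congr (inv_ne_zero ((map_ne_zero σ).2 hϖk)) (by rw [map_inv₀, map_inv₀, hvσ])

end Literature.NumberTheory.Automorphic.UnitaryLatticeTree

end
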